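import Summits.QuantumFields.YangMills.Theorems.LuscherReductionDressedRitzPolyakovLiftStaticsOfSeparationCertified
import HarnessLib

/-!
# Line «polyakovlift» on crux `DressedRitz` (stmt-QuantumFields-20205), stub S-STAT — the certificates are SYMMETRIC, so `OneSiteCertifiedAt k` only needs
# the pairs `i < l`

Fleet-service module of seat ym-infvol-p1 g6 (route `LuscherReduction`, femto rung R2b1).  Small toolkit for the users of the S-STAT capstone
(`…StaticsOfSeparationCertified.lean`): `PairSeparated.symm`, `PairCertified.symm`, and `oneSiteCertifiedAt_of_lt` — to establish the ONE-type hypothesis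
of record it suffices to certify each UNORDERED pair of channels once.

HONEST FRAMING: certificate bookkeeping on the conditional femto rung R2b1; no renormalisation-group content; nothing here bears on infinite volume, the
continuum limit or the Clay gap.  Reference: M. Lüscher, NPB 219 (1983) 233, §2 [cite: Luscher1983, §2].
-/

set_option autoImplicit false

noncomputable section

open MeasureTheory Filter Topology
open Literature.MathematicalPhysics.QuantumFieldTheory
open scoped BigOperators

namespace Summit.QuantumFields.YangMills.Theorems.FemtoTransferGap.PolyakovLift

open Summit.QuantumFields.YangMills.Theorems.FemtoTransferGap

/-- `PairSeparated` is symmetric in the two channels. [folklore] -/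
theorem PairSeparated.symm {f h : GaugeConfig 3 1 SU2 → ℝ} (hs : PairSeparated f h) : PairSeparated h f := by
  rcases hs with ⟨σ, hσ, hinv, hpar⟩ | ⟨J, hJ, γ, ι, w, hγ, hγι, hw, htw⟩ | ⟨n, e, a₀, σ, τ, p, q, he, hσ, hτ, hpq, hfe, hhe⟩
  · exact Or.inl ⟨σ, hσ, hinv, hpar.symm⟩
  · exact Or.inr (Or.inl ⟨J, hJ, γ, ι, w, hγ, hγι, hw, htw.symm⟩)
  · refine Or.inr (Or.inr ⟨n, e, a₀, σ, τ, q, p, he, hσ, hτ, ?_, hhe, hfe⟩)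
    rw [← hpq]
    exact Finset.sum_congr rfl fun a _ => mul_comm _ _

/-- `PairCertified` is symmetric in the two channels. [folklore] -/
theorem PairCertified.symm {f h : GaugeConfig 3 1 SU2 → ℝ} (hc : PairCertified f h) : PairCertified h f := by
  rcases hc with hs | hd
  · exact Or.inl hs.symm
  · exact Or.inr hd.symm

/-- **It suffices to certify the pairs `i < l`.** [folklore] -/
theorem pairCertified_all_of_lt {k : ℕ} {g : Fin k → (GaugeConfig 3 1 SU2 → ℝ)}
    (h : ∀ i l : Fin k, i < l → PairCertified (g i) (g l)) : ∀ i l : Fin k, i ≠ l → PairCertified (g i) (g l) := by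
  intro i l hil
  rcases lt_or_gt_of_ne hil with hlt | hgt
  · exact h i l hlt
  · exact (h l i hgt).symm

/-- ★ **`OneSiteCertifiedAt k` from unordered pairs**: for all `0 < Λ ≤ Λ₀` and every lift basis at `B₁ = 2/Λ³`, certifying each pair `i < l` suffices.
[cite: Luscher1983, §2] -/
theorem oneSiteCertifiedAt_of_lt {k : ℕ} {lam0 : ℝ} (hlam0 : 0 < lam0)
    (h : ∀ Λ : ℝ, 0 < Λ → Λ ≤ lam0 →
      ∀ (ω : GaugeConfig 3 1 SU2 → ℝ) (g : Fin k → (GaugeConfig 3 1 SU2 → ℝ)), LiftBasis (2 / Λ ^ 3) k ω g →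
        ∀ i l : Fin k, i < l → PairCertified (g i) (g l)) :
    OneSiteCertifiedAt k :=
  ⟨lam0, hlam0, fun Λ hΛ hle ω g hb => pairCertified_all_of_lt (h Λ hΛ hle ω g hb)⟩

/-- Levels `k ≤ 1` are certified vacuously (no pair of distinct channels): the capstone reproduces seat g5's `dressed_stub_liftStatics_le_one`. [folklore] -/
theorem oneSiteCertifiedAt_of_le_one {k : ℕ} (hk : k ≤ 1) : OneSiteCertifiedAt k := by
  refine ⟨1, one_pos, fun Λ _ _ ω g _ i l hil => ?_⟩
  exfalso
  have : Subsingleton (Fin k) := by interval_cases k <;> infer_instance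
  exact hil (Subsingleton.elim i l)

end Summit.QuantumFields.YangMills.Theorems.FemtoTransferGap.PolyakovLift

end
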